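import Summits.ResolutionOfSingularities.ResolutionOfSingularities.Theorems.UniversalCellsCampaignW82ExponentZeroGraded
import Summits.ResolutionOfSingularities.ResolutionOfSingularities.Theorems.UniversalCellsCampaignW82KollarCurve
import Summits.ResolutionOfSingularities.ResolutionOfSingularities.Theorems.UniversalCellsCampaignW82RegularFormProofs
import Summits.ResolutionOfSingularities.ResolutionOfSingularities.Theorems.UniversalCellsCampaignW82GeometricallyReduced
import Literature.AlgebraicGeometry.Resolution.FundamentalLocus
import Literature.AlgebraicGeometry.Resolution.SmoothStalksRegular
import Literature.AlgebraicGeometry.Resolution.ResolutionGlue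
import Literature.AlgebraicGeometry.Resolution.ProjectiveSpaceRegular
import Literature.AlgebraicGeometry.Resolution.RegularLocalRingsNormal
import Literature.AlgebraicGeometry.Resolution.ResolutionOfCurves
import Mathlib.FieldTheory.IsPerfectClosure
import HarnessLib

/-!
# [OURS · L1 W8.2] EXPONENT ZERO IS NOT ENOUGH — Kollár's regular curve has no smooth proper birational model
# over `𝔽_p(t)`; the residual of slot W8.2 with the Frobenius exponent pinned to `0` is FALSE at grade `1`

Cell `res-hironaka` (run/shared/lean/pub/res-hironaka/), LADDER-RESOLUTION rung L (RESCUE), slot W8.2 of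
plan/RESCUE-SEED.md («PRIME-FIELD / UNIVERSALITY TRANSFER instead of descent»), host route `UniversalCells`, host
item `PrimeFieldToPerfect` (stmt-ResolutionOfSingularities-15233); second door `UniformComplexity`
`PrimeModelTransfer` (stmt-ResolutionOfSingularities-8933). Proofs AGAINST the OURS statement module
Theorems/UniversalCellsCampaignW82ExponentZeroGraded.lean (`CampaignW82.HasSmoothProperBirationalModel`,
`CampaignW82.SmoothModelStepRegularAt`), written by the slot's prover res-L1-s82-pv-1 (gen 3). Theses-free
(the link to the crux's Disproof signature is the sibling leaf Theorems/UniversalCellsCampaignW82ExponentZeroLinks.lean).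

CONTEXT. The residual of slot W8.2 (both doors) is kernel-certified in four equivalent normal forms
(`residual_normalForms_tfae`, Theorems/UniversalCellsCampaignW82RegularFormProofs.lean), the sharpest being
`FrobeniusTwistStepRegularAt p M n`: «Res(≤ n) over `M(t)` ⇒ SOME Frobenius twist of every REGULAR irreducible
geometrically reduced `X₀` of dimension `≤ n` over `M(t)` has a proper birational model SMOOTH over `M(t)`». It
holds for `n ≤ 1` unconditionally and for `n ≤ 3` from F-02, and is open for `n ≥ 4`. The crux documents name
the strengthening «exponent `e = 0` suffices» as the first thing a proof may not do
(Cruxes/PrimeFieldToPerfect/KERNEL.md §4 (s1); Disproof.lean §3, near-miss `not_smoothTwist_levelZero`, left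
with `sorry` on 2026-08-17 because "a proper birational morphism onto a regular curve is an isomorphism" was
not in the tree). It now is (Literature/AlgebraicGeometry/Resolution/FundamentalLocus.lean, Zariski / Piltant
2013: `mem_isoLocus_of_ringKrullDim_le_one`, `isIso_morphismRestrict_isoLocus`), and this file closes the gap.

WHAT IS PROVED (everything a theorem; no `sorry`, no new axioms):

* §1 `isIso_of_isBirational_of_isRegular_of_ringKrullDim_le_one` — UNIQUENESS OF THE REGULAR MODEL OF A CURVE:
  a proper birational morphism of integral schemes onto a locally Noetherian regular scheme whose local rings
  have dimension `≤ 1` is an isomorphism (iso locus = everything; isomorphisms are local on the target).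
* §2 the pinned predicate implies both genuine conclusion predicates:
  `hasSmoothFrobeniusTwistModel_of_hasSmoothProperBirationalModel` (`e = 0`: `Frob^0 = id`),
  `hasSmoothModelAtFiniteLevel_of_hasSmoothProperBirationalModel` (`K' = K`), hence
  `frobeniusTwistStepRegularAt_of_smoothModelStepRegularAt` (pinned step ⇒ genuine step).
* §3 the witness `C = Spec 𝔽_p(t)[X,Y]/(Y^q − X^p + t)`, `p ∤ q` (commutative algebra in the sibling
  Theorems/UniversalCellsCampaignW82KollarCurve.lean): `KollarCurve.integralOverPerfectClosure` (over Mathlib's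
  `PerfectClosure`), `.isIntegral`, `.isRegular`, `.ringKrullDim_stalk_le_one`, `.topologicalKrullDim_le_one`,
  and the core **`KollarCurve.not_hasSmoothProperBirationalModel`**: NO proper birational `π : Y ⟶ C` has `Y`
  smooth over `𝔽_p(t)` — `Y` would be reduced hence integral, `π` an isomorphism (§1), `C → Spec 𝔽_p(t)` smooth,
  its base change to `K = 𝔽_p(t^{1/p})` regular (Stacks 056S, tree `isRegularLocalRing_stalk_of_smooth_of_field`),
  i.e. `K ⊗ A ≅ K[X,Y]/(Y^q − (X − t^{1/p})^p)` a regular ring — contradicting the barrier decl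
  `Literature.Barriers.ResolutionOfSingularities.not_isRegularLocalRing_cuspIdeal`. Also
  `KollarCurve.hasSmoothFrobeniusTwistModel`: SOME twist of `C` does have a smooth model (rung `n ≤ 1`), so the
  exponent of `C` is `≥ 1` (it is `1`: `y^q = (x − t^{1/p})^p` is smoothed by one normalisation — not proved).
* §4 **`not_smoothModelStepRegularAt_zmod_one`**: `¬ SmoothModelStepRegularAt (ZMod p) 1` for EVERY prime `p`
  (`q = p + 1`; the hypothesis — resolution of curves over `𝔽_p(t)` — is the tree theorem
  `Resolution.hasResolution_of_dim_le_one`, so the negation is informative); `not_forall_smoothModelStepRegularAt_one`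
  (the door-1 graded shape, pinned, is false); and the juxtaposition
  `frobeniusTwistStepRegularAt_one_and_not_smoothModelStepRegularAt_one`:
  `FrobeniusTwistStepRegularAt p (ZMod p) 1 ∧ ¬ SmoothModelStepRegularAt (ZMod p) 1`.

WHAT THIS SAYS FOR THE SLOT (honest grade). Nothing here bears on the open residual `n ≥ 4` itself; it is a
TIGHTNESS certificate for its normal form: the existential over the Frobenius exponent (equivalently over the
finite purely inseparable level `K'`) is load-bearing from dimension `1` on, so any proof of
`PerfectionStepAt M n` must re-resolve AFTER twisting (KERNEL.md §3/§4: "weak, non-functorial resolution gives no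
handle … `m = 0`" is exactly what fails). The door-2 forms (`M` algebraically closed / `(𝔽_p(s))^{alg} ∩ K`) are
not refuted here: the witness lives over `M = 𝔽_p` (the barrier entry's field); the same curve over `M(t)` for any
`M` of characteristic `p` would do, but the barrier computation is vendored only for `𝔽_p(t)`.
-- TODO(general form): Kollár 1.19 holds over `k(t)` for every field `k` of characteristic `p`; the tree's
-- barrier entry (hence this file) fixes `k = 𝔽_p`.

HONEST FRAMING. OURS campaign theorems about OURS statements that REPLACE THE ROLE of §17 ¶2, p.89 l.59–62 of
H. Hironaka's manuscript [Hironaka2017] (reformulation over the prime field at transcendence degree one; typed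
AS PRINTED as `S17Methodology.U89_3`): the printed «resolve a model over `𝔽_p` and restrict» produces a REGULAR
generic fibre, and this file certifies that regular-without-twisting is insufficient. NOT statements of the
manuscript; nothing is attributed to its author; no typed candidate of the manuscript is used, even as a
hypothesis. AI work, weaker than expert review.

BARRIERS (catalogue `Literature/Barriers/ResolutionOfSingularities/`): this file CONSUMES
`RegularNotGeometricallyRegular.lean` (Kollár 1.19: `isRegularLocalRing_kollarPoint`,
`not_isRegularLocalRing_cuspIdeal`, `kollarRingExtEquiv`) and globalises it; `FrobeniusTwistResolution.lean` /
`InseparableBaseChangeResolution.lean` are not engaged.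

## References (locators; nothing cited as a premise)
* J. Kollár, *Lectures on Resolution of Singularities* (2007), 1.19 "Curves over nonperfect fields". [Kollar2007]
* Q. Liu, *Algebraic Geometry and Arithmetic Curves* (2002), Cor. 4.4.3, Prop. 7.3.13, Ex. 7.3.15, Rem. 4.3.34. [Liu2002]
* O. Piltant, *An axiomatic version of Zariski's patching theorem* (2013), §2 — via the tree's FundamentalLocus. [Piltant2013]
* The Stacks Project, Tag 056S (smooth over a field ⇒ regular). [StacksProject]
* Cruxes/PrimeFieldToPerfect/KERNEL.md §4 (s1), Disproof.lean §3; L/res-L1-s82-pv-1/NOTES.md — cell files, OURS.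
-/

noncomputable section

set_option linter.dupNamespace false -- mandated namespace of this single-conjunct summit

open _root_.CategoryTheory _root_.CategoryTheory.Limits _root_.AlgebraicGeometry TensorProduct
open Literature.AlgebraicGeometry.Resolution Literature.Barriers.ResolutionOfSingularities

namespace Summit.ResolutionOfSingularities.ResolutionOfSingularities.Theorems.CampaignW82

universe u

/-! ## §1 A proper birational morphism onto a regular curve is an isomorphism -/

/-- **Uniqueness of the regular model in dimension one.** A proper birational morphism `g : T ⟶ Y` of
integral schemes onto a locally Noetherian REGULAR scheme all of whose local rings have dimension `≤ 1` is an
isomorphism: every point of `Y` lies in the iso locus of `g` (Zariski: a proper birational morphism is an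
isomorphism over the normal points of codimension `≤ 1`, tree
`Resolution.mem_isoLocus_of_ringKrullDim_le_one`; regular local rings are normal, Matsumura 19.4), and being
an isomorphism is local on the target. (Liu 2002, Cor. 4.4.3 / Prop. 7.3.13 territory: two regular proper
models of a function field of curves coincide.) [cite: Liu2002, Cor. 4.4.3] -/
theorem isIso_of_isBirational_of_isRegular_of_ringKrullDim_le_one {T Y : Scheme.{u}} [IsIntegral T]
    [IsIntegral Y] [IsLocallyNoetherian Y] (g : T ⟶ Y) [IsProper g] (hg : IsBirational g)
    (hreg : Scheme.IsRegular Y) (hdim : ∀ y : Y, ringKrullDim (Y.presheaf.stalk y) ≤ 1) : IsIso g := by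
  have hV₀ : ∀ y ∈ (⊤ : Y.Opens), IsIntegrallyClosed (Y.presheaf.stalk y) := fun y _ =>
    haveI := hreg y
    isIntegrallyClosed_of_isRegularLocalRing _
  have htop : g.isoLocus = ⊤ :=
    top_le_iff.mp fun y _ => mem_isoLocus_of_ringKrullDim_le_one g hg ⊤ hV₀ (TopologicalSpace.Opens.mem_top y) (hdim y)
  have hcov : ⨆ _ : Unit, g.isoLocus = ⊤ := by rw [iSup_const, htop]
  have h : MorphismProperty.isomorphisms Scheme g :=
    IsZariskiLocalAtTarget.of_iSup_eq_top (P := MorphismProperty.isomorphisms Scheme) _ hcov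
      fun _ => isIso_morphismRestrict_isoLocus g
  exact h

/-! ## §2 The pinned predicate implies both genuine conclusion predicates -/

/-- If `g : Spec K ⟶ Spec K` is the identity, a smooth proper birational model of `X₀` over `K` is a smooth
proper birational model of `X₀ ×_{K,g} Spec K`. [folklore] -/
theorem exists_smoothModel_pullback_of_eq_id {K : Type u} [Field K] {X₀ : Scheme.{u}}
    {f₀ : X₀ ⟶ Spec (.of K)} (h : HasSmoothProperBirationalModel K f₀)
    (g : Spec (.of K) ⟶ Spec (.of K)) (hg : g = 𝟙 _) :
    ∃ (Y : Scheme.{u}) (π : Y ⟶ pullback f₀ g),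
      IsProper π ∧ IsBirational π ∧ Smooth (π ≫ pullback.snd f₀ g) := by
  subst hg
  obtain ⟨Y, π, hP, hB, hS⟩ := h
  refine ⟨Y, π ≫ inv (pullback.fst f₀ (𝟙 _)), ?_, hB.comp_iso _, ?_⟩
  · exact MorphismProperty.RespectsIso.postcomp (P := @IsProper) _ _ hP
  · have h2 : inv (pullback.fst f₀ (𝟙 _)) ≫ pullback.snd f₀ (𝟙 _) = f₀ := by
      rw [IsIso.inv_comp_eq, ← Category.comp_id (pullback.snd f₀ (𝟙 _))]
      exact pullback.condition.symm
    rw [Category.assoc, h2]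
    exact hS

/-- **Pinned ⇒ Frobenius-twist form**: a smooth proper birational model over `K` is a smooth model of the
`0`-th Frobenius twist (`Frob^0 = id`). [folklore] -/
theorem hasSmoothFrobeniusTwistModel_of_hasSmoothProperBirationalModel (p : ℕ) (K : Type u) [Field K]
    [ExpChar K p] {X₀ : Scheme.{u}} {f₀ : X₀ ⟶ Spec (.of K)} (h : HasSmoothProperBirationalModel K f₀) :
    HasSmoothFrobeniusTwistModel p K f₀ :=
  ⟨0, exists_smoothModel_pullback_of_eq_id h _ (by rw [iterateFrobenius_zero, CommRingCat.ofHom_id, Spec.map_id])⟩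

/-- **Pinned ⇒ finite-level form**: a smooth proper birational model over `K` is a smooth model at the
trivial level `K' = K`. [folklore] -/
theorem hasSmoothModelAtFiniteLevel_of_hasSmoothProperBirationalModel (K : Type u) [Field K]
    {X₀ : Scheme.{u}} {f₀ : X₀ ⟶ Spec (.of K)} (h : HasSmoothProperBirationalModel K f₀) :
    HasSmoothModelAtFiniteLevel K f₀ :=
  ⟨K, inferInstance, inferInstance, inferInstance, inferInstance,
    exists_smoothModel_pullback_of_eq_id h _ (by rw [Algebra.algebraMap_self, CommRingCat.ofHom_id, Spec.map_id])⟩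

/-- **The pinned step implies the genuine regular normal form** (pure logic + `e = 0`). [folklore] -/
theorem frobeniusTwistStepRegularAt_of_smoothModelStepRegularAt {p : ℕ} [Fact p.Prime] {M : Type}
    [Field M] [CharP M p] {n : WithBot ℕ∞} (h : SmoothModelStepRegularAt M n) :
    FrobeniusTwistStepRegularAt p M n :=
  fun hM X₀ f₀ hs hl hq hd hint hreg =>
    hasSmoothFrobeniusTwistModel_of_hasSmoothProperBirationalModel p _
      (h hM X₀ f₀ hs hl hq hd hint hreg)

/-! ## §3 The witness: Kollár's curve `C = Spec 𝔽_p(t)[X,Y]/(Y^q − X^p + t)`, `p ∤ q` -/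

namespace KollarCurve

variable (p : ℕ) [hp : Fact p.Prime] (q : ℕ) [hq : Fact (1 < q)]

omit hq in
/-- The structure morphism `C ⟶ Spec 𝔽_p(t)` is locally of finite type (a theorem, not an instance:
use `haveI`). [folklore] -/
theorem locallyOfFiniteType_f₀ :
    LocallyOfFiniteType (Spec.map (CommRingCat.ofHom (algebraMap (baseField p) (kollarRing p q)))) :=
  HasRingHomProperty.Spec_iff.mpr (RingHom.finiteType_algebraMap.mpr inferInstance)

omit hq in
/-- **`C` is integral over the perfect closure** (`IntegralOverPerfectClosure`): over Mathlib's
`PerfectClosure 𝔽_p(t) p`, in which `t` has a `p`-th root `c`, the base change is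
`Spec` of the domain `L ⊗ₖ A` (`KollarCurve.isDomain_tensor_kollarRing`). [cite: Liu2002, Example 7.3.15 and Remark 4.3.34] -/
theorem integralOverPerfectClosure (hpq : ¬ p ∣ q) :
    IntegralOverPerfectClosure (baseField p)
      (Spec.map (CommRingCat.ofHom (algebraMap (baseField p) (kollarRing p q)))) := by
  let L := PerfectClosure (baseField p) p
  letI : Algebra (baseField p) L := (PerfectClosure.of (baseField p) p).toAlgebra
  haveI : IsPRadical (algebraMap (baseField p) L) p :=
    inferInstanceAs (IsPRadical (PerfectClosure.of (baseField p) p) p)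
  haveI : IsPurelyInseparable (baseField p) L := IsPRadical.isPurelyInseparable (baseField p) L p
  refine ⟨L, inferInstance, inferInstance, inferInstance, inferInstance, ?_⟩
  obtain ⟨c, hc⟩ := surjective_frobenius L p (algebraMap (baseField p) L RatFunc.X)
  haveI : IsDomain (L ⊗[baseField p] kollarRing p q) :=
    isDomain_tensor_kollarRing p q hpq L c (by simpa [frobenius_def] using hc)
  haveI : IsDomain (kollarRing p q ⊗[baseField p] L) :=
    (Algebra.TensorProduct.comm (baseField p) (kollarRing p q) L).toMulEquiv.isDomain _
  exact IsIntegral.of_isIso (pullbackSpecIso (baseField p) (kollarRing p q) L).inv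

omit hq in
/-- `C` is an integral scheme. [folklore] -/
theorem isIntegral (hpq : ¬ p ∣ q) : IsIntegral (Spec (.of (kollarRing p q))) :=
  (integralOverPerfectClosure p q hpq).isIntegral

/-- `C` is a regular scheme (`KollarCurve.isRegularRing_kollarRing`). [cite: Kollar2007, 1.19 (Curves over nonperfect fields)] -/
theorem isRegular (hpq : ¬ p ∣ q) : Scheme.IsRegular (Spec (.of (kollarRing p q))) :=
  haveI := isRegularRing_kollarRing p q hpq
  Scheme.isRegular_Spec _

/-- The local rings of `C` have dimension `≤ 1`. [folklore] -/
theorem ringKrullDim_stalk_le_one (x : Spec (.of (kollarRing p q))) :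
    ringKrullDim ((Spec (.of (kollarRing p q))).presheaf.stalk x) ≤ 1 := by
  rw [ringKrullDim_eq_of_ringEquiv (Spec.stalkIso (.of (kollarRing p q)) x).commRingCatIsoToRingEquiv,
    IsLocalization.AtPrime.ringKrullDim_eq_height x.asIdeal (Localization.AtPrime x.asIdeal),
    ← ringKrullDim_kollarRing p q]
  exact Ideal.height_le_ringKrullDim_of_ne_top x.2.ne_top

/-- `dim C ≤ 1`. [folklore] -/
theorem topologicalKrullDim_le_one :
    topologicalKrullDim (Spec (.of (kollarRing p q))) ≤ 1 := by
  rw [show topologicalKrullDim (Spec (.of (kollarRing p q))) = ringKrullDim (kollarRing p q) from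
    PrimeSpectrum.topologicalKrullDim_eq_ringKrullDim (kollarRing p q), ringKrullDim_kollarRing p q]

/-- **KOLLÁR'S REGULAR CURVE HAS NO SMOOTH PROPER BIRATIONAL MODEL OVER `𝔽_p(t)`** (`p ∤ q`). If
`π : Y ⟶ C` were proper birational with `Y` smooth over `k = 𝔽_p(t)`, then `Y` is reduced (smooth over a
field), hence integral, and `π` is an isomorphism (§1: `C` is a regular curve); so `C ⟶ Spec k` would be
smooth, hence so would be its base change `C_K ⟶ Spec K`, `K = k(t^{1/p})`, whose local rings would then all
be regular (Stacks 056S) — but `C_K = Spec K[X,Y]/(Y^q − (X − t^{1/p})^p)` is not regular at `(t^{1/p}, 0)`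
(barrier decl `Literature.Barriers.ResolutionOfSingularities.not_isRegularLocalRing_cuspIdeal`). This is the
global form of Kollár 2007, 1.19 — the content of the near-miss `not_smoothTwist_levelZero` of
Cruxes/PrimeFieldToPerfect/Disproof.lean §3. [cite: Kollar2007, 1.19 (Curves over nonperfect fields)] -/
theorem not_hasSmoothProperBirationalModel (hpq : ¬ p ∣ q) :
    ¬ HasSmoothProperBirationalModel (baseField p)
      (Spec.map (CommRingCat.ofHom (algebraMap (baseField p) (kollarRing p q)))) := by
  rintro ⟨Y, π, hP, hB, hS⟩
  set f₀ := Spec.map (CommRingCat.ofHom (algebraMap (baseField p) (kollarRing p q))) with hf₀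
  haveI := isIntegral p q hpq
  haveI : IsReduced Y := isReduced_of_smooth (π ≫ f₀)
  haveI : IsIntegral Y := hB.isIntegral
  haveI : IsIso π := isIso_of_isBirational_of_isRegular_of_ringKrullDim_le_one π hB (isRegular p q hpq)
    (ringKrullDim_stalk_le_one p q)
  haveI : Smooth f₀ := by
    have : f₀ = inv π ≫ (π ≫ f₀) := by simp
    rw [this]
    infer_instance
  -- base change to `K = k(t^{1/p})`
  let ι := Spec.map (CommRingCat.ofHom (algebraMap (baseField p) (extField p)))
  have hreg : Scheme.IsRegular (pullback f₀ ι) := fun y =>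
    isRegularLocalRing_stalk_of_smooth_of_field (pullback.snd f₀ ι) y
  have hreg' : Scheme.IsRegular (Spec (.of (kollarRing p q ⊗[baseField p] extField p))) :=
    Scheme.IsRegular.of_iso (pullbackSpecIso (baseField p) (kollarRing p q) (extField p)).hom hreg
  let e : kollarRing p q ⊗[baseField p] extField p ≃+* kollarRingExt p q :=
    (Algebra.TensorProduct.comm (baseField p) (kollarRing p q) (extField p)).toRingEquiv.trans
      (kollarRingExtEquiv p q).toRingEquiv
  haveI : IsNoetherianRing (kollarRing p q ⊗[baseField p] extField p) :=
    isNoetherianRing_of_ringEquiv (kollarRingExt p q) (S := kollarRing p q ⊗[baseField p] extField p) e.symm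
  haveI : IsRegularRing (kollarRing p q ⊗[baseField p] extField p) :=
    (Scheme.isRegular_Spec_iff (CommRingCat.of (kollarRing p q ⊗[baseField p] extField p))).mp hreg'
  haveI : IsRegularRing (kollarRingExt p q) :=
    IsRegularRing.of_ringEquiv (R := kollarRing p q ⊗[baseField p] extField p) e
  exact not_isRegularLocalRing_cuspIdeal p q inferInstance

/-- …whereas SOME Frobenius twist of `C` does have a smooth proper birational model (the unconditional rung
`n ≤ 1`: `hasSmoothFrobeniusTwistModel_of_dim_le_one`); with the previous theorem, the exponent is `≥ 1`.
[folklore] -/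
theorem hasSmoothFrobeniusTwistModel (hpq : ¬ p ∣ q) :
    HasSmoothFrobeniusTwistModel p (baseField p)
      (Spec.map (CommRingCat.ofHom (algebraMap (baseField p) (kollarRing p q)))) :=
  haveI := locallyOfFiniteType_f₀ p q
  hasSmoothFrobeniusTwistModel_of_dim_le_one p (baseField p) _ (topologicalKrullDim_le_one p q)
    (integralOverPerfectClosure p q hpq)

end KollarCurve

/-! ## §4 The pinned step is FALSE at the first grade, while the genuine step holds there -/

/-- `p ∤ p + 1` for a prime `p`. [folklore] -/
theorem not_dvd_succ_self (p : ℕ) [hp : Fact p.Prime] : ¬ p ∣ p + 1 := by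
  intro h
  have h1 : p ∣ 1 := (Nat.dvd_add_right (dvd_refl p)).mp h
  exact hp.out.one_lt.ne' (Nat.dvd_one.mp h1)

/-- **`¬ SmoothModelStepRegularAt (ZMod p) 1`, every prime `p`** — THE EXPONENT IS LOAD-BEARING AT THE FIRST
GRADE. The hypothesis of the pinned step (resolution of integral curves over `𝔽_p(t)`) is a theorem
(`Resolution.hasResolution_of_dim_le_one`); its conclusion fails for Kollár's curve `y^{p+1} = x^p − t`
(separated of finite type, dimension `1`, integral over the perfect closure, REGULAR:
`KollarCurve.not_hasSmoothProperBirationalModel`). [cite: Kollar2007, 1.19 (Curves over nonperfect fields)] -/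
theorem not_smoothModelStepRegularAt_zmod_one (p : ℕ) [hp : Fact p.Prime] :
    ¬ SmoothModelStepRegularAt (ZMod p) 1 := by
  haveI : Fact (1 < p + 1) := ⟨by have := hp.out.one_lt; omega⟩
  intro h
  have hyp : ∀ (X : Scheme.{0}) (f : X ⟶ Spec (.of (RatFunc (ZMod p)))),
      IsSeparated f → LocallyOfFiniteType f → QuasiCompact f → IsIntegral X →
        topologicalKrullDim X ≤ 1 → Scheme.HasResolution X := by
    intro X f _ _ _ _ hd
    exact hasResolution_of_dim_le_one X f hd
  exact KollarCurve.not_hasSmoothProperBirationalModel p (p + 1) (not_dvd_succ_self p)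
    (h hyp _ _ inferInstance (KollarCurve.locallyOfFiniteType_f₀ p (p + 1)) inferInstance
      (KollarCurve.topologicalKrullDim_le_one p (p + 1))
      (KollarCurve.integralOverPerfectClosure p (p + 1) (not_dvd_succ_self p))
      (KollarCurve.isRegular p (p + 1) (not_dvd_succ_self p)))

/-- Hence the door-1 graded shape with the exponent pinned — `∀ M perfect of characteristic p,
SmoothModelStepRegularAt M 1` — is false for every prime `p` (witness `M = 𝔽_p`). [cite: Kollar2007, 1.19 (Curves over nonperfect fields)] -/
theorem not_forall_smoothModelStepRegularAt_one (p : ℕ) [Fact p.Prime] :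
    ¬ ∀ (M : Type) [Field M] [CharP M p] [PerfectField M], SmoothModelStepRegularAt M 1 :=
  fun h => not_smoothModelStepRegularAt_zmod_one p (h (ZMod p))

/-- **TIGHTNESS OF THE RESIDUAL'S NORMAL FORM AT GRADE 1.** For every prime `p`: the genuine regular normal
form holds at `(𝔽_p, 1)` — `FrobeniusTwistStepRegularAt p (ZMod p) 1` (`frobeniusTwistStepRegularAt_of_le_one`,
unconditional) — while its exponent-zero pinning fails there. So `∃ e` in
`CampaignW82.HasSmoothFrobeniusTwistModel` (equivalently the finite level `K'` in
`HasSmoothModelAtFiniteLevel`) cannot be dropped from the residual of slot W8.2, already for curves; any proof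
of the residual in dimension `n ≥ 4` must TWIST. [cite: Kollar2007, 1.19 (Curves over nonperfect fields)] -/
theorem frobeniusTwistStepRegularAt_one_and_not_smoothModelStepRegularAt_one (p : ℕ) [Fact p.Prime] :
    FrobeniusTwistStepRegularAt p (ZMod p) 1 ∧ ¬ SmoothModelStepRegularAt (ZMod p) 1 :=
  ⟨frobeniusTwistStepRegularAt_of_le_one p (ZMod p) le_rfl, not_smoothModelStepRegularAt_zmod_one p⟩

/-! ## v2 (append-only): EVERY grade `n ≥ 1` — at `𝔽_p` the pinned step is the NEGATION of its own hypothesis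

Everything above this line is byte-identical with v1 (p503383). Appended by res-L1-s82-pv-1 (gen 3). The witness
curve has dimension `1`, so the CONCLUSION block of `SmoothModelStepRegularAt (ZMod p) n` fails at every grade
`n ≥ 1`; hence for such `n` the pinned step holds iff its hypothesis — resolution of integral varieties of
dimension `≤ n` over `𝔽_p(t)` — FAILS. Consequences: `¬ SmoothModelStepRegularAt (ZMod p) n` for `1 ≤ n ≤ 3`
given FACT-LIST F-02 (`CossartPiltant2019`, explicit hypothesis), and at `n = ⊤` the pinned «residual» is
EQUIVALENT to the failure of resolution over `𝔽_p(t)` — in particular refuted by `ResolutionInChar p`. So, unlike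
the four genuine normal forms (all implied by the summit), the exponent-zero form is ANTI-implied by it. -/

/-- **The conclusion block of the pinned step fails at `𝔽_p` in every grade `n ≥ 1`** (unconditional): Kollár's
curve `y^{p+1} = x^p − t` is a separated regular `𝔽_p(t)`-scheme of finite type of dimension `1 ≤ n`, integral
over the perfect closure, without a smooth proper birational model over `𝔽_p(t)`
(`KollarCurve.not_hasSmoothProperBirationalModel`). [cite: Kollar2007, 1.19 (Curves over nonperfect fields)] -/
theorem not_smoothModelStepRegularAt_conclusion_zmod (p : ℕ) [hp : Fact p.Prime] {n : WithBot ℕ∞}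
    (hn : 1 ≤ n) :
    ¬ ∀ (X₀ : Scheme.{0}) (f₀ : X₀ ⟶ Spec (.of (RatFunc (ZMod p)))),
      IsSeparated f₀ → LocallyOfFiniteType f₀ → QuasiCompact f₀ → topologicalKrullDim X₀ ≤ n →
        IntegralOverPerfectClosure (RatFunc (ZMod p)) f₀ → Scheme.IsRegular X₀ →
          HasSmoothProperBirationalModel (RatFunc (ZMod p)) f₀ := by
  haveI : Fact (1 < p + 1) := ⟨by have := hp.out.one_lt; omega⟩
  intro h
  exact KollarCurve.not_hasSmoothProperBirationalModel p (p + 1) (not_dvd_succ_self p)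
    (h _ _ inferInstance (KollarCurve.locallyOfFiniteType_f₀ p (p + 1)) inferInstance
      ((KollarCurve.topologicalKrullDim_le_one p (p + 1)).trans hn)
      (KollarCurve.integralOverPerfectClosure p (p + 1) (not_dvd_succ_self p))
      (KollarCurve.isRegular p (p + 1) (not_dvd_succ_self p)))

/-- **At `𝔽_p`, in every grade `n ≥ 1`, the pinned step HOLDS IFF ITS HYPOTHESIS FAILS**:
`SmoothModelStepRegularAt (ZMod p) n ↔ ¬ (resolution of integral separated schemes of finite type of dimension
≤ n over 𝔽_p(t))` (pure logic from the previous theorem). [folklore] -/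
theorem smoothModelStepRegularAt_zmod_iff_not_hyp (p : ℕ) [Fact p.Prime] {n : WithBot ℕ∞} (hn : 1 ≤ n) :
    SmoothModelStepRegularAt (ZMod p) n ↔
      ¬ ∀ (X : Scheme.{0}) (f : X ⟶ Spec (.of (RatFunc (ZMod p)))),
        IsSeparated f → LocallyOfFiniteType f → QuasiCompact f → IsIntegral X →
          topologicalKrullDim X ≤ n → Scheme.HasResolution X :=
  ⟨fun h hyp => not_smoothModelStepRegularAt_conclusion_zmod p hn (h hyp),
    fun h hyp => absurd hyp h⟩

/-- **`¬ SmoothModelStepRegularAt (ZMod p) n` for `1 ≤ n ≤ 3`, CONDITIONAL on FACT-LIST F-02** (`hCP :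
CossartPiltant2019`, which supplies the hypothesis: resolution in dimension `≤ 3` over every field). Grade `1`
is unconditional (`not_smoothModelStepRegularAt_zmod_one`). [cite: CossartPiltant2019, Thm. 1.1] -/
theorem not_smoothModelStepRegularAt_zmod_of_le_three (hCP : CossartPiltant2019.{0}) (p : ℕ) [Fact p.Prime]
    {n : WithBot ℕ∞} (h1 : 1 ≤ n) (h3 : n ≤ 3) : ¬ SmoothModelStepRegularAt (ZMod p) n :=
  fun h => (smoothModelStepRegularAt_zmod_iff_not_hyp p h1).mp h fun X f hs hl hq _ hd =>
    hCP (RatFunc (ZMod p)) X f hs hl hq inferInstance (hd.trans h3)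

/-- **At `n = ⊤` the exponent-zero «residual» at `𝔽_p` is EQUIVALENT TO THE FAILURE OF RESOLUTION OVER
`𝔽_p(t)`**: `SmoothModelStepRegularAt (ZMod p) ⊤ ↔ ¬ (every integral separated 𝔽_p(t)-scheme of finite type has a
resolution)`. Contrast: the four genuine normal forms of the residual are implied by the summit; this pinned form
is refuted by it (`not_smoothModelStepRegularAt_zmod_top_of_resolutionInChar`). [folklore] -/
theorem smoothModelStepRegularAt_zmod_top_iff (p : ℕ) [Fact p.Prime] :
    SmoothModelStepRegularAt (ZMod p) ⊤ ↔
      ¬ ∀ (X : Scheme.{0}) (f : X ⟶ Spec (.of (RatFunc (ZMod p)))),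
        IsSeparated f → LocallyOfFiniteType f → QuasiCompact f → IsIntegral X → Scheme.HasResolution X := by
  rw [smoothModelStepRegularAt_zmod_iff_not_hyp p le_top]
  exact not_congr ⟨fun h X f hs hl hq hi => h X f hs hl hq hi le_top,
    fun h X f hs hl hq hi _ => h X f hs hl hq hi⟩

/-- **Resolution in characteristic `p` refutes the exponent-zero «residual» at `𝔽_p`** (`n = ⊤`): if
`ResolutionInChar p` holds (e.g. from the summit), then `¬ SmoothModelStepRegularAt (ZMod p) ⊤`. [folklore] -/
theorem not_smoothModelStepRegularAt_zmod_top_of_resolutionInChar (p : ℕ) [Fact p.Prime]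
    (h : ResolutionInChar.{0} p) : ¬ SmoothModelStepRegularAt (ZMod p) ⊤ :=
  fun hs => (smoothModelStepRegularAt_zmod_top_iff p).mp hs fun X f hs' hl hq _ =>
    h (RatFunc (ZMod p)) X f hs' hl hq inferInstance

end Summit.ResolutionOfSingularities.ResolutionOfSingularities.Theorems.CampaignW82

end
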